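import Summits.QuantumFields.YangMills.Theorems.VirialFluxGapRegularityCutoffDerivative
import Summits.QuantumFields.YangMills.Theorems.VirialFluxGapFixFrameStd
import HarnessLib

/-!
# Route `VirialFluxGap` (YangMills): the regularity cut-off `χ_reg` — NON-NEGATIVE CHAIN-RULE WEIGHTS (`∂_Y χ_reg = Σ_k w_k·∂_Y m_k`, `0 ≤ w_k ≤ C/ρ²`)
# and the summed slot bound `Σ_va |∂_va m_k| ≤ 6` in the standard frame of `X_fix` (assembler's requests (R5), (R6), fcl-p3 g41 2026-08-31)

✓`VirialFluxGapRegularityCutoff` ∕ ✓`…Derivative` (w2 g52) define `χ_reg = regCutoff ρ = 1 − ψ(m₀/ρ²)ψ(m₁/ρ²)ψ(m₂/ρ²)ψ(m_s/ρ²)` and bound `|∂_Y χ_reg| ≤ C/ρ²`.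
The assembler (fcl-p3 g41, bus 01:35Z) needs the SIGNED structure of the derivative — it is what makes the cross term of the patching one-signed up
to `O(√t₀)`: since `ψ′ ≤ 0` and `ψ ≥ 0`,
  `∂_Y χ_reg(M) = Σ_{k<3} w_k(M)·∂_Y m_k(M) + w_s(M)·∂_Y m_s(M)`,  `w_k = −(Π_{l≠k} ψ_l)·ψ′(m_k/ρ²)/ρ² ∈ [0, C_ψ/ρ²]`
(weights independent of the direction `Y`).  This file exports exactly that, plus the summed slot bound in w2 g51's standard frame:

* ★★ `frameD_regCutoff_eq_weighted` — the identity with the EXPLICIT weights (all `M`, all `Y`); `regWeights_nonneg_le` — each weight is in `[0, C_ψ/ρ²]`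
  for the absolute `C_ψ` of ✓`exists_bound_deriv_deficitStep`; ★★★ `exists_regCutoff_weights` — packaged: `∃ C ≥ 0, ∀ L ρ>0 M, ∃ w : Fin 3 → ℝ, ∃ w_s,
  (0 ≤ w_k ≤ C/ρ²) ∧ (0 ≤ w_s ≤ C/ρ²) ∧ ∀ Y, ∂_Yχ_reg(M) = Σ_k w_k ∂_Y m_k(M) + w_s ∂_Y m_s(M)` ((R5));
* ★ `sum_abs_frameD_linkMass_le` ∕ `sum_abs_frameD_seamMass_le` — `Σ_{va : FixVar L × Fin 3} |∂_{fixFrameStd va} m(ringCoord P)| ≤ 6` ((R6): only the three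
  directions at the mass's own variable are non-zero, each `≤ 2` by ✓`abs_frameD_linkMass_le`).

HONEST FRAMING: plumbing (theorems only, 0 `def`, 0 `sorry`, standard axioms); the patching inequalities, the central field and the assembly are NOT here;
⟨stmt-QuantumFields-24141⟩ and ⟨22884⟩ stay OPEN; no stub ∕ crux ∕ rung ∕ summit is closed; the Yang–Mills mass gap is NOT proved; no summit is proved
by a line.  Width seat `ym-line-sfw-p2-w2` g52 (cell ym-idea-1, free hands), `--supports stmt-QuantumFields-24141`.
References: [cite: Luscher1983, §2]; [folklore] (partitions of unity).
-/

set_option autoImplicit false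

noncomputable section

open scoped Matrix BigOperators ContDiff Topology
open MeasureTheory
open Literature.MathematicalPhysics.QuantumFieldTheory hiding SU2
open Literature.MathematicalPhysics.QuantumLattice
open Literature.MathematicalPhysics.QuantumFieldTheory.SUNBakryEmery (expSU coe_expSU matTop)

namespace Summit.QuantumFields.YangMills.Theorems.VirialFluxGap.RegCutoff

open Summit.QuantumFields.YangMills.Theorems.FemtoTransferGap
open Summit.QuantumFields.YangMills.Theorems.FemtoTransferGap.TT
open Summit.QuantumFields.YangMills.Theorems.VirialFluxGap.RingDeficit
open Summit.QuantumFields.YangMills.Theorems.VirialFluxGap.FrameDerivative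
open Summit.QuantumFields.YangMills.Theorems.VirialFluxGap.FrameHessian
open Summit.QuantumFields.YangMills.Theorems.VirialFluxGap.FixFrame

variable {L : ℕ} [NeZero L]

open scoped Matrix.Norms.Frobenius

attribute [local instance 2000] Literature.MathematicalPhysics.QuantumFieldTheory.SUNBakryEmery.matTop

/-! ## §1 The signed chain rule: non-negative weights -/

/-- ★★ **The derivative of `χ_reg` as a NON-NEGATIVELY weighted combination of the derivatives of the masses**, with explicit weights
`w_k = −(Π_{l≠k} ψ(m_l/ρ²))·ψ′(m_k/ρ²)/ρ²` (independent of the direction `Y`). [folklore] -/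
theorem frameD_regCutoff_eq_weighted (ρ : ℝ) (Y : ((Fin (2 * L - 1 + 1) × Edge 3 L) ⊕ Site 3 L) → Matrix (Fin 2) (Fin 2) ℂ)
    (M : (Fin (2 * L - 1 + 1) → Edge 3 L → Matrix (Fin 2) (Fin 2) ℂ) × (Site 3 L → Matrix (Fin 2) (Fin 2) ℂ)) :
    frameD Y (regCutoff ρ) M =
      (-(deficitStep (linkMass 1 M / ρ ^ 2) * deficitStep (linkMass 2 M / ρ ^ 2) * deficitStep (seamMass M / ρ ^ 2)) *
          deriv deficitStep (linkMass 0 M / ρ ^ 2) / ρ ^ 2) * frameD Y (linkMass 0) M +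
      (-(deficitStep (linkMass 0 M / ρ ^ 2) * deficitStep (linkMass 2 M / ρ ^ 2) * deficitStep (seamMass M / ρ ^ 2)) *
          deriv deficitStep (linkMass 1 M / ρ ^ 2) / ρ ^ 2) * frameD Y (linkMass 1) M +
      (-(deficitStep (linkMass 0 M / ρ ^ 2) * deficitStep (linkMass 1 M / ρ ^ 2) * deficitStep (seamMass M / ρ ^ 2)) *
          deriv deficitStep (linkMass 2 M / ρ ^ 2) / ρ ^ 2) * frameD Y (linkMass 2) M +
      (-(deficitStep (linkMass 0 M / ρ ^ 2) * deficitStep (linkMass 1 M / ρ ^ 2) * deficitStep (linkMass 2 M / ρ ^ 2)) *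
          deriv deficitStep (seamMass M / ρ ^ 2) / ρ ^ 2) * frameD Y seamMass M := by
  have hA : ∀ k : Fin 3, ContDiff ℝ ∞ fun M' : ((Fin (2 * L - 1 + 1) → Edge 3 L → Matrix (Fin 2) (Fin 2) ℂ) × (Site 3 L → Matrix (Fin 2) (Fin 2) ℂ)) =>
      deficitStep (linkMass k M' / ρ ^ 2) := fun k => contDiff_deficitStep.comp ((contDiff_linkMass k).div_const _)
  have hD : ContDiff ℝ ∞ fun M' : ((Fin (2 * L - 1 + 1) → Edge 3 L → Matrix (Fin 2) (Fin 2) ℂ) × (Site 3 L → Matrix (Fin 2) (Fin 2) ℂ)) =>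
      deficitStep (seamMass M' / ρ ^ 2) := contDiff_deficitStep.comp (contDiff_seamMass.div_const _)
  unfold regCutoff
  rw [frameD_one_sub, frameD_mul (((hA 0).mul (hA 1)).mul (hA 2)) hD, frameD_mul ((hA 0).mul (hA 1)) (hA 2), frameD_mul (hA 0) (hA 1),
    frameD_step_factor (contDiff_linkMass 0), frameD_step_factor (contDiff_linkMass 1), frameD_step_factor (contDiff_linkMass 2),
    frameD_step_factor contDiff_seamMass]
  ring

omit [NeZero L] in
/-- Each chain-rule weight `−(a·b·c)·ψ′(r)/ρ²` with `a,b,c ∈ [0,1]` step values is in `[0, C_ψ/ρ²]`. [folklore] -/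
theorem regWeight_nonneg_le {a b c r ρ Cψ : ℝ} (hρ : 0 < ρ) (hCψ : ∀ t : ℝ, |deriv deficitStep t| ≤ Cψ)
    (ha : 0 ≤ a) (ha1 : a ≤ 1) (hb : 0 ≤ b) (hb1 : b ≤ 1) (hc : 0 ≤ c) (hc1 : c ≤ 1) :
    0 ≤ -(a * b * c) * deriv deficitStep r / ρ ^ 2 ∧ -(a * b * c) * deriv deficitStep r / ρ ^ 2 ≤ Cψ / ρ ^ 2 := by
  have hρ2 : 0 < ρ ^ 2 := by positivity
  have hψ' : deriv deficitStep r ≤ 0 := deriv_deficitStep_nonpos r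
  have habc : 0 ≤ a * b * c := by positivity
  have habc1 : a * b * c ≤ 1 := mul_le_one₀ (mul_le_one₀ ha1 hb hb1) hc hc1
  have hC : -deriv deficitStep r ≤ Cψ := by
    have := hCψ r; rw [abs_le] at this; linarith [this.1]
  constructor
  · exact div_nonneg (by nlinarith) hρ2.le
  · rw [div_le_div_iff_of_pos_right hρ2]
    nlinarith

/-- ★★★ **(R5) The signed chain rule, packaged**: an absolute `C ≥ 0` such that at every point `M` there are weights `w_k, w_s ∈ [0, C/ρ²]`
(independent of the direction) with `∂_Y χ_reg(M) = Σ_k w_k·∂_Y m_k(M) + w_s·∂_Y m_s(M)` for every assignment `Y`. [folklore] -/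
theorem exists_regCutoff_weights : ∃ C : ℝ, 0 ≤ C ∧ ∀ (L : ℕ) [NeZero L] (ρ : ℝ), 0 < ρ →
    ∀ M : (Fin (2 * L - 1 + 1) → Edge 3 L → Matrix (Fin 2) (Fin 2) ℂ) × (Site 3 L → Matrix (Fin 2) (Fin 2) ℂ),
      ∃ (w : Fin 3 → ℝ) (ws : ℝ), (∀ k, 0 ≤ w k ∧ w k ≤ C / ρ ^ 2) ∧ (0 ≤ ws ∧ ws ≤ C / ρ ^ 2) ∧
        ∀ Y : ((Fin (2 * L - 1 + 1) × Edge 3 L) ⊕ Site 3 L) → Matrix (Fin 2) (Fin 2) ℂ,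
          frameD Y (regCutoff ρ) M = (∑ k : Fin 3, w k * frameD Y (linkMass k) M) + ws * frameD Y seamMass M := by
  obtain ⟨Cψ, hCψ0, hCψ⟩ := exists_bound_deriv_deficitStep
  refine ⟨Cψ, hCψ0, fun L _ ρ hρ M => ?_⟩
  have h01 : ∀ t : ℝ, 0 ≤ deficitStep t ∧ deficitStep t ≤ 1 := fun t => ⟨deficitStep_nonneg t, deficitStep_le_one t⟩
  set a0 := deficitStep (linkMass 0 M / ρ ^ 2)
  set a1 := deficitStep (linkMass 1 M / ρ ^ 2)
  set a2 := deficitStep (linkMass 2 M / ρ ^ 2)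
  set a3 := deficitStep (seamMass M / ρ ^ 2)
  refine ⟨![-(a1 * a2 * a3) * deriv deficitStep (linkMass 0 M / ρ ^ 2) / ρ ^ 2,
      -(a0 * a2 * a3) * deriv deficitStep (linkMass 1 M / ρ ^ 2) / ρ ^ 2,
      -(a0 * a1 * a3) * deriv deficitStep (linkMass 2 M / ρ ^ 2) / ρ ^ 2],
    -(a0 * a1 * a2) * deriv deficitStep (seamMass M / ρ ^ 2) / ρ ^ 2, fun k => ?_, ?_, fun Y => ?_⟩
  · have h3 : ∀ i : Fin 3, i = 0 ∨ i = 1 ∨ i = 2 := by decide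
    rcases h3 k with rfl | rfl | rfl
    · exact regWeight_nonneg_le hρ hCψ (h01 _).1 (h01 _).2 (h01 _).1 (h01 _).2 (h01 _).1 (h01 _).2
    · exact regWeight_nonneg_le hρ hCψ (h01 _).1 (h01 _).2 (h01 _).1 (h01 _).2 (h01 _).1 (h01 _).2
    · exact regWeight_nonneg_le hρ hCψ (h01 _).1 (h01 _).2 (h01 _).1 (h01 _).2 (h01 _).1 (h01 _).2
  · exact regWeight_nonneg_le hρ hCψ (h01 _).1 (h01 _).2 (h01 _).1 (h01 _).2 (h01 _).1 (h01 _).2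
  · rw [frameD_regCutoff_eq_weighted, Fin.sum_univ_three]
    simp only [Matrix.cons_val]
    ring

/-! ## §2 (R6) Summed slot bounds in the standard frame of `X_fix` -/

/-- A non-negative function on `FixVar L × Fin 3` supported on the fibre `{va : fixVar va.1 = w₀}` and bounded by `b` there has sum `≤ 3b`
(`fixVar` is injective, so the fibre is at most one variable times three directions). [folklore] -/
theorem sum_le_three_mul_of_fibre {f : FixVar L × Fin 3 → ℝ} {w₀ : (Fin (2 * L - 1 + 1) × Edge 3 L) ⊕ Site 3 L} {b : ℝ} (hb : 0 ≤ b)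
    (hf0 : ∀ va, fixVar va.1 ≠ w₀ → f va = 0) (hfb : ∀ va, f va ≤ b) : ∑ va, f va ≤ 3 * b := by
  classical
  rw [Fintype.sum_prod_type]
  by_cases hex : ∃ v₀ : FixVar L, fixVar v₀ = w₀
  · obtain ⟨v₀, hv₀⟩ := hex
    rw [Finset.sum_eq_single v₀]
    · calc ∑ a : Fin 3, f (v₀, a) ≤ ∑ _a : Fin 3, b := Finset.sum_le_sum fun a _ => hfb _
        _ = 3 * b := by rw [Finset.sum_const, Finset.card_univ, Fintype.card_fin, nsmul_eq_mul]; ring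
    · intro v _ hv
      exact Finset.sum_eq_zero fun a _ => hf0 (v, a) fun h => hv (fixVar_injective (h.trans hv₀.symm))
    · intro h; exact absurd (Finset.mem_univ v₀) h
  · push Not at hex
    rw [Finset.sum_eq_zero fun v _ => Finset.sum_eq_zero fun a _ => hf0 (v, a) (hex v)]
    positivity

/-- ★ **(R6) for a link mass**: in the standard frame `Σ_{va} |∂_{fixFrameStd va} m_k(ringCoord P)| ≤ 6` (only the three directions at the wrap link
`(0, wrapEdge k)` are non-zero, each `≤ 2`). [folklore] -/
theorem sum_abs_frameD_linkMass_le (k : Fin 3) (P : (Fin (2 * L - 1 + 1) → GaugeConfig 3 L SU2) × (Site 3 L → SU2)) :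
    ∑ va : FixVar L × Fin 3, |frameD (fixFrameStd va) (linkMass k) (ringCoord L P)| ≤ 6 := by
  have h := sum_le_three_mul_of_fibre (L := L) (f := fun va => |frameD (fixFrameStd va) (linkMass k) (ringCoord L P)|)
    (w₀ := Sum.inl (0, wrapEdge k)) (b := 2) (by norm_num) (fun va hva => ?_) (fun va => abs_frameD_linkMass_le k (norm_fixFrameStd_le va) P)
  · linarith
  · rw [frameD_linkMass_eq_zero k (by rw [fixFrameStd_apply, if_neg (Ne.symm hva)]), abs_zero]

/-- ★ **(R6) for the seam mass**: `Σ_{va} |∂_{fixFrameStd va} m_s(ringCoord P)| ≤ 6`. [folklore] -/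
theorem sum_abs_frameD_seamMass_le (P : (Fin (2 * L - 1 + 1) → GaugeConfig 3 L SU2) × (Site 3 L → SU2)) :
    ∑ va : FixVar L × Fin 3, |frameD (fixFrameStd va) seamMass (ringCoord L P)| ≤ 6 := by
  have h := sum_le_three_mul_of_fibre (L := L) (f := fun va => |frameD (fixFrameStd va) seamMass (ringCoord L P)|)
    (w₀ := Sum.inr 0) (b := 2) (by norm_num) (fun va hva => ?_) (fun va => abs_frameD_seamMass_le (norm_fixFrameStd_le va) P)
  · linarith
  · rw [frameD_seamMass_eq_zero (by rw [fixFrameStd_apply, if_neg (Ne.symm hva)]), abs_zero]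

end Summit.QuantumFields.YangMills.Theorems.VirialFluxGap.RegCutoff

end
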